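import Summits.QuantumFields.YangMills.Theorems.UnitScaleTiltProp7SectET3LandauOpRowsT3
import HarnessLib

/-!
# Route `UnitScaleTilt`, crux «MinimiserStabilityRegPr» (stmt-QuantumFields-19200, stub EX), node N06(d = 3), route (α) — LAYER 0, ROWS (def-free):
# **«HDH-SLOT» — THE (S)-SUB-ROW `hΔH` ([Balaban1985Variational] (137)–(140) «`D*DH`, `Δ_{U₀}H` bounded in |·|₍₋₃₎») FOR A GENERIC CHART LETTER `Hx` AT A GENERIC HESSIAN SLOT `Δx`,
# FROM THE BACKGROUND-LEVEL ROWS OF RECORD** — the letter-and-slot-generic form of ✓`Prop7SectET3LandauOpRows.hΔH_of_opRows` (✓p663021 §4, which is pinned to `H46` at `DeltaPiSlot` and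
# carries `hq : PosPrime`, EMPTY by ★px16's certificate #54): here the letter enters ONLY through three displayed rows — its Landau row `hLandau` ((45)₂ `R_SD*H = 0`), its slot row `hslotH`
# ((137) at the slot: `Δx(H Y) = η·(Q_k†(QGQ*)⁻¹Ỹ − Q_k†aỸ)`) and its size `h46` ((46)₀) — and the slot ONLY through `hslotH` and the slot-defect row `hOp139′`; NO `PosOnto`, NO `PosPrime`,
# NO `G′` letter.  Instance of record after the PINV cascade (★★OWNER RULING g28-№4 (C2′), ACK 80 P2∕P5): `Hx := H46ᴾ`, `Δx := DeltaPiSlotᴾ` (one line once ★px18's P2 rows land)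

Cell `ym3-torus` (HUMAN RULING D-0037, YM ladder rung R3 — YM₃ on T³, NOT d = 4, NOT Clay; YM gap NOT proved), width seat `ym3-torus-px5` (gen 2; FILL-TO-CAP «width 5»; P5 «HDH-PINV» of the
PINV cascade, typed slot-generically).  THEOREMS ONLY (0 `def`, 0 `sorry`); `--supports stmt-QuantumFields-19200 --as helper`; count-neutral; NO claim on crux ∕ stub ∕ registry; nothing of
[Balaban1985BackgroundPropagators] §3 is asserted — the rows ARE print's inputs, displayed by name.

THE DISPLAYED ROWS (member `F`, `h : n ≤ K`, weights `c₀ cB a`, slot `Δx`, background `U₀ ∈ RegPr ε₀`, letter `Hx : (PBond (F.P n) 0 → M₂(ℂ)) → (PBond (F.P K) 0 → M₂(ℂ))`):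
* letter rows: `hLandau : ∀ Y, R_S(D*(toL2 (Hx Y))) = 0` [(45)₂; for `H46`: ✓`landauS_H46`; for `H46ᴾ`: P2]; `hslotH : ∀ Y, Δx U₀ (toL2 (Hx Y)) = η • (Qk†(KinvT …Δx U₀ (toL2B Y)) − Qk†(a • toL2B Y))`
  [(137) «Δ_πH = Q*(QGQ*)⁻¹(Lʲη)⁻¹ − Q*a(Lʲη)⁻¹» at the slot; for `H46`: ✓`Prop7SectET3H137Rows.DeltaPi_HT` lineage; for `H46ᴾ`: P2]; `h46 : ‖Hx Y b‖ ≤ BH·η·‖Y‖` [(46)₀; KH1 lineage].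
* background rows (EX residue-row shapes of record, ★w2-19200 g6 (G18)∕(G25)): `h137` (generic `Y`, `KinvT …Δx`), `hOp139′` (slot defect on the Landau class, ✓`…LandauOpRows127`'s text),
  `hOp349` ((3.49), slot-free).  INHABITABILITY (№9 (3)): as recorded in ✓p663021∕✓`…LandauOpRows127` — all η-free, no Calderón–Zygmund operator; `hslotH`∕`hLandau` are identities of the letter.

WHAT IS PROVED (ns `…Theorems.Prop7SectET3HDeltaHOfOpRowsSlot`):
* §1 ★★ `norm_DeltaEta_Hx_le` — «|ΔHB|₍₋₃₎ ≦ O(1)|B|»: `‖toL2⁻¹(Δ^η(toL2 (Hx Y))) b‖ ≤ (c₁₃₇ + k₁₃₉·BH)·η·‖Y‖` (`Δ^η = Δx + (Δ^η − Δx)`, `hslotH`, `h137`, `hOp139′` at the Landau field `Hx Y`).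
* §2 ★★★ `covCodiffCurlT_Hx_le` — «|D*DHB|₍₋₃₎ ≦ O(1)|B|»: `‖D¹*D¹(Hx Y)‖ ≤ (c₁₃₇ + k₁₃₉·BH + 28·ε₀·BH)·η³·‖Y‖` (§1 + Δ310-EXPLICIT ✓`h310_holds` + (46)₀).
* §3 ★★★ `covLapFormT_Hx_le` — «|Δ_{U₀}HB|₍₋₃₎ ≦ O(1)|B|»: `‖Δ¹(Hx Y)‖ ≤ (c₁₃₇ + k₁₃₉·BH + 28·ε₀·BH + k₃₄₉·BH + 4·ε₀·BH)·η³·‖Y‖` (§2 + (135) ✓`Prop7SecondOrderDict` + (140)×(3.49) via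
  ✓`hDPD_of_op349` at the Landau field `Hx Y`).
* §4 ★★★ `hΔH_of_opRows_slot` — the two-conjunct `hΔH` text for `Hx` with ONE constant `BH″ := c₁₃₇ + k₁₃₉·BH + k₃₄₉·BH + (28 + 4)·ε₀·BH` (= ✓p663021 §4's constant).
HONEST SCOPE.  Triangle inequalities and the scale exchange `η⁻² ↔ η²` over displayed rows; the rows are NOT proved here (N06(d = 3)); not a proof of any stub; nothing continuum ∕ OS ∕ mass-gap ∕ Clay.

References: T. Bałaban, CMP **102** (1985) 277–309 [Balaban1985Variational] ((137)–(140) pp.298–299, (19) p.281, (45)–(46) p.285); CMP **99** (1985) 389–434 [Balaban1985BackgroundPropagators]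
((3.10) p.392, (3.49) p.399, (3.119)–(3.126) pp.419–420).
-/

set_option autoImplicit false

noncomputable section

open scoped InnerProductSpace ComplexConjugate Matrix.Norms.L2Operator

namespace Summit.QuantumFields.YangMills.Theorems.Prop7SectET3HDeltaHOfOpRowsSlot

open Literature.MathematicalPhysics.QuantumFieldTheory.Balaban1983to89
open Literature.MathematicalPhysics.QuantumFieldTheory.Balaban1983to89.T3ContinuumYM3Torus
open Literature.MathematicalPhysics.QuantumFieldTheory.Balaban1983to89.T3PrintedRegularMinimiser (RegPr)
open T3SectALandauChart (eta eta_pos covDerivFwdT covCodiffCurlT covLapFormT covDivFormT bgUnits)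
open B9SectCLatticeCarrier (Bond)
open B9Eq311L2Pairing (WL2)
open B11Eq103H1Complex (SiteL2K BondL2K)
open Summit.QuantumFields.YangMills.Theorems.Prop7SectET3Transport (periodsT3)
open Summit.QuantumFields.YangMills.Theorems.Prop7SectET3HilbertLetters (W₂ toL2 toL2S toL2B DL2 DstarL2)
open Summit.QuantumFields.YangMills.Theorems.Prop7SectET3GaugeProjector (NS RS)
open Summit.QuantumFields.YangMills.Theorems.Prop7SectET3WilsonHessian (DeltaEta)
open Summit.QuantumFields.YangMills.Theorems.Prop7SectET3CurvedPropagators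
open Summit.QuantumFields.YangMills.Theorems.Prop7SectET3DeltaPi
open Summit.QuantumFields.YangMills.Theorems.Prop7SectET3DeltaEtaExplicit (h310_holds)
open Summit.QuantumFields.YangMills.Theorems.Prop7SecondOrderDict (norm_covCodiffCurlT_sub_covLapFormT_add_gradDiv_le_of_regPr)
open Summit.QuantumFields.YangMills.Theorems.Prop7SectET3LandauOpRows (hDPD_of_op349 k_nonneg_of_op349)

variable {F : T3Family} {n K : ℕ} {h : n ≤ K} {c₀ cB a : ℝ} [Fact (0 < c₀)] [Fact (0 < cB)]
  {Δx : GaugeField (F.P K) 0 (Matrix.specialUnitaryGroup (Fin 2) ℂ) → (BondL2K ℂ 3 (periodsT3 F K) c₀ W₂ →ₗ[ℂ] BondL2K ℂ 3 (periodsT3 F K) c₀ W₂)}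

/-! ## §1 «|ΔHB|₍₋₃₎ ≦ O(1)|B|» for a generic letter at a generic slot -/

/-- ★★ **`‖toL2⁻¹(Δ^η(toL2 (Hx Y))) b‖ ≤ (c₁₃₇ + k₁₃₉·BH)·η·‖Y‖`** — print's (139) «|ΔHB|₍₋₃₎ ≦ O(1)|B|» for a letter `Hx` known only through its slot row (137) `hslotH`, its Landau row (45)₂ `hLandau`
and its size (46)₀ `h46`: `Δ^η = Δx + (Δ^η − Δx)` with the generic-`Y` (137) row `h137` and the slot-defect row `hOp139′` read at the Landau field `Hx Y`.
[cite: Balaban1985Variational, (137)–(139) pp.298–299, (45)–(46) p.285] -/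
theorem norm_DeltaEta_Hx_le (U₀ : GaugeField (F.P K) 0 (Matrix.specialUnitaryGroup (Fin 2) ℂ))
    (Hx : (PBond (F.P n) 0 → Matrix (Fin 2) (Fin 2) ℂ) → (PBond (F.P K) 0 → Matrix (Fin 2) (Fin 2) ℂ)) {BH c137 k139 : ℝ}
    (hLandau : ∀ Y, RS F n K h c₀ cB U₀ (DstarL2 F n K c₀ U₀ (toL2 F K c₀ (Hx Y))) = 0)
    (hslotH : ∀ Y, Δx U₀ (toL2 F K c₀ (Hx Y))
      = (((eta F n K : ℝ) : ℂ)) • (LinearMap.adjoint (Qk F n K h c₀ cB U₀) (KinvT F n K h c₀ cB a Δx U₀ (toL2B F n cB Y))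
          - LinearMap.adjoint (Qk F n K h c₀ cB U₀) (((a : ℂ)) • toL2B F n cB Y)))
    (h46 : ∀ (Y : PBond (F.P n) 0 → Matrix (Fin 2) (Fin 2) ℂ) (b : PBond (F.P K) 0), ‖Hx Y b‖ ≤ BH * eta F n K * ‖Y‖)
    (h137 : ∀ (Y : PBond (F.P n) 0 → Matrix (Fin 2) (Fin 2) ℂ) (b : PBond (F.P K) 0),
      ‖(toL2 F K c₀).symm (LinearMap.adjoint (Qk F n K h c₀ cB U₀) (KinvT F n K h c₀ cB a Δx U₀ (toL2B F n cB Y))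
          - LinearMap.adjoint (Qk F n K h c₀ cB U₀) (((a : ℂ)) • toL2B F n cB Y)) b‖ ≤ c137 * ‖Y‖)
    (hOp139 : ∀ (X : PBond (F.P K) 0 → Matrix (Fin 2) (Fin 2) ℂ) (s : ℝ), RS F n K h c₀ cB U₀ (DstarL2 F n K c₀ U₀ (toL2 F K c₀ X)) = 0 → (∀ bd, ‖X bd‖ ≤ s) →
      ∀ bd : PBond (F.P K) 0, ‖(toL2 F K c₀).symm (DeltaEta F n K c₀ U₀ (toL2 F K c₀ X) - Δx U₀ (toL2 F K c₀ X)) bd‖ ≤ k139 * s)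
    (Y : PBond (F.P n) 0 → Matrix (Fin 2) (Fin 2) ℂ) (b : PBond (F.P K) 0) :
    ‖(toL2 F K c₀).symm (DeltaEta F n K c₀ U₀ (toL2 F K c₀ (Hx Y))) b‖ ≤ (c137 + k139 * BH) * eta F n K * ‖Y‖ := by
  have hη : 0 < eta F n K := eta_pos F n K
  have hsplit : DeltaEta F n K c₀ U₀ (toL2 F K c₀ (Hx Y))
      = Δx U₀ (toL2 F K c₀ (Hx Y)) + (DeltaEta F n K c₀ U₀ (toL2 F K c₀ (Hx Y)) - Δx U₀ (toL2 F K c₀ (Hx Y))) := by abel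
  rw [hsplit, map_add, Pi.add_apply]
  refine (norm_add_le _ _).trans ?_
  have h1 : ‖(toL2 F K c₀).symm (Δx U₀ (toL2 F K c₀ (Hx Y))) b‖ ≤ eta F n K * (c137 * ‖Y‖) := by
    rw [hslotH Y, map_smul, Pi.smul_apply, norm_smul, Complex.norm_real, Real.norm_of_nonneg hη.le]
    exact mul_le_mul_of_nonneg_left (h137 Y b) hη.le
  have h2 := hOp139 (Hx Y) (BH * eta F n K * ‖Y‖) (hLandau Y) (fun bd => h46 Y bd) b
  calc _ ≤ eta F n K * (c137 * ‖Y‖) + k139 * (BH * eta F n K * ‖Y‖) := add_le_add h1 h2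
    _ = (c137 + k139 * BH) * eta F n K * ‖Y‖ := by ring

/-! ## §2 «|D*DHB|₍₋₃₎ ≦ O(1)|B|» -/

/-- ★★★ **`‖D¹*_{U₀}D¹_{U₀}(Hx Y)‖ ≤ (c₁₃₇ + k₁₃₉·BH + 28·ε₀·BH)·η³·‖Y‖`** — print's «|D*DHB|₍₋₃₎ ≦ O(1)|B|» (p. 299 l.9): §1 + Δ310-EXPLICIT (✓`h310_holds`: `Δ^η = η⁻²D¹*D¹ + Δ′`,
`‖Δ′X‖ ≤ 28ε₀·sup‖X‖` on `RegPr`) + (46)₀ and the scale exchange `η⁻² ↔ η²`. [cite: Balaban1985Variational, (139) p.299, (19) p.281; Balaban1985BackgroundPropagators, (3.10) p.392] -/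
theorem covCodiffCurlT_Hx_le {ε₀ : ℝ} {U₀ : GaugeField (F.P K) 0 (Matrix.specialUnitaryGroup (Fin 2) ℂ)} (hreg : RegPr F n K ε₀ U₀)
    (Hx : (PBond (F.P n) 0 → Matrix (Fin 2) (Fin 2) ℂ) → (PBond (F.P K) 0 → Matrix (Fin 2) (Fin 2) ℂ)) {BH c137 k139 : ℝ}
    (hLandau : ∀ Y, RS F n K h c₀ cB U₀ (DstarL2 F n K c₀ U₀ (toL2 F K c₀ (Hx Y))) = 0)
    (hslotH : ∀ Y, Δx U₀ (toL2 F K c₀ (Hx Y))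
      = (((eta F n K : ℝ) : ℂ)) • (LinearMap.adjoint (Qk F n K h c₀ cB U₀) (KinvT F n K h c₀ cB a Δx U₀ (toL2B F n cB Y))
          - LinearMap.adjoint (Qk F n K h c₀ cB U₀) (((a : ℂ)) • toL2B F n cB Y)))
    (h46 : ∀ (Y : PBond (F.P n) 0 → Matrix (Fin 2) (Fin 2) ℂ) (b : PBond (F.P K) 0), ‖Hx Y b‖ ≤ BH * eta F n K * ‖Y‖)
    (h137 : ∀ (Y : PBond (F.P n) 0 → Matrix (Fin 2) (Fin 2) ℂ) (b : PBond (F.P K) 0),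
      ‖(toL2 F K c₀).symm (LinearMap.adjoint (Qk F n K h c₀ cB U₀) (KinvT F n K h c₀ cB a Δx U₀ (toL2B F n cB Y))
          - LinearMap.adjoint (Qk F n K h c₀ cB U₀) (((a : ℂ)) • toL2B F n cB Y)) b‖ ≤ c137 * ‖Y‖)
    (hOp139 : ∀ (X : PBond (F.P K) 0 → Matrix (Fin 2) (Fin 2) ℂ) (s : ℝ), RS F n K h c₀ cB U₀ (DstarL2 F n K c₀ U₀ (toL2 F K c₀ X)) = 0 → (∀ bd, ‖X bd‖ ≤ s) →
      ∀ bd : PBond (F.P K) 0, ‖(toL2 F K c₀).symm (DeltaEta F n K c₀ U₀ (toL2 F K c₀ X) - Δx U₀ (toL2 F K c₀ X)) bd‖ ≤ k139 * s)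
    (Y : PBond (F.P n) 0 → Matrix (Fin 2) (Fin 2) ℂ) (μ : Fin (F.P K).d) (x : Site (F.P K) 0) :
    ‖covCodiffCurlT 1 (bgUnits F K U₀) (Hx Y) μ x‖ ≤ (c137 + k139 * BH + 28 * ε₀ * BH) * eta F n K ^ 3 * ‖Y‖ := by
  have hη : 0 < eta F n K := eta_pos F n K
  set Fv := Hx Y with hFv
  have hΔ := norm_DeltaEta_Hx_le (h := h) U₀ Hx hLandau hslotH h46 h137 hOp139 Y ⟨x, μ⟩
  have h3 := h310_holds (n := n) (c₀ := c₀) U₀ hreg Fv (BH * eta F n K * ‖Y‖) (fun b => h46 Y b) ⟨x, μ⟩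
  rw [← hFv] at hΔ
  have hsc : ‖((((eta F n K)⁻¹ ^ 2 : ℝ) : ℂ)) • covCodiffCurlT 1 (bgUnits F K U₀) Fv μ x‖
      ≤ (c137 + k139 * BH) * eta F n K * ‖Y‖ + 28 * ε₀ * (BH * eta F n K * ‖Y‖) := by
    have htri := norm_sub_le_norm_sub_add_norm_sub
      (((((eta F n K)⁻¹ ^ 2 : ℝ) : ℂ)) • covCodiffCurlT 1 (bgUnits F K U₀) Fv μ x)
      ((toL2 F K c₀).symm (DeltaEta F n K c₀ U₀ (toL2 F K c₀ Fv)) ⟨x, μ⟩) (0 : Matrix (Fin 2) (Fin 2) ℂ)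
    rw [sub_zero, sub_zero, norm_sub_rev] at htri
    linarith
  have hηn : ‖((((eta F n K)⁻¹ ^ 2 : ℝ) : ℂ))‖ = (eta F n K)⁻¹ ^ 2 := by
    rw [Complex.norm_real, Real.norm_of_nonneg (by positivity)]
  rw [norm_smul, hηn] at hsc
  have hη2 : 0 < eta F n K ^ 2 := by positivity
  have hkey : ‖covCodiffCurlT 1 (bgUnits F K U₀) Fv μ x‖
      ≤ eta F n K ^ 2 * ((c137 + k139 * BH) * eta F n K * ‖Y‖ + 28 * ε₀ * (BH * eta F n K * ‖Y‖)) := by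
    have := mul_le_mul_of_nonneg_left hsc hη2.le
    have hcancel : eta F n K ^ 2 * ((eta F n K)⁻¹ ^ 2 * ‖covCodiffCurlT 1 (bgUnits F K U₀) Fv μ x‖)
        = ‖covCodiffCurlT 1 (bgUnits F K U₀) Fv μ x‖ := by
      field_simp
    linarith [hcancel]
  calc ‖covCodiffCurlT 1 (bgUnits F K U₀) Fv μ x‖
      ≤ eta F n K ^ 2 * ((c137 + k139 * BH) * eta F n K * ‖Y‖ + 28 * ε₀ * (BH * eta F n K * ‖Y‖)) := hkey
    _ = (c137 + k139 * BH + 28 * ε₀ * BH) * eta F n K ^ 3 * ‖Y‖ := by ring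

/-! ## §3 «|Δ_{U₀}HB|₍₋₃₎ ≦ O(1)|B|» via (135) and (140)×(3.49) -/

/-- ★★★ **`‖Δ¹_{U₀}(Hx Y)‖ ≤ (c₁₃₇ + k₁₃₉·BH + 28·ε₀·BH + k₃₄₉·BH + 4·ε₀·BH)·η³·‖Y‖`** — print's «|Δ_{U₀}HB|₍₋₃₎ ≦ O(1)|B|» (p. 299 l.14): §2 + (135) in the `nMax19` letters
(✓`norm_covCodiffCurlT_sub_covLapFormT_add_gradDiv_le_of_regPr`) + the (140)-step «`DD*HB = DPD*HB`, `DPD*` bounded» through ✓`hDPD_of_op349` at the Landau field `Hx Y` + (46)₀.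
[cite: Balaban1985Variational, (140) p.299, (135) p.298, (19) p.281; Balaban1985BackgroundPropagators, (3.49) p.399] -/
theorem covLapFormT_Hx_le {ε₀ : ℝ} {U₀ : GaugeField (F.P K) 0 (Matrix.specialUnitaryGroup (Fin 2) ℂ)} (hreg : RegPr F n K ε₀ U₀)
    (Hx : (PBond (F.P n) 0 → Matrix (Fin 2) (Fin 2) ℂ) → (PBond (F.P K) 0 → Matrix (Fin 2) (Fin 2) ℂ)) {BH c137 k139 k349 : ℝ}
    (hLandau : ∀ Y, RS F n K h c₀ cB U₀ (DstarL2 F n K c₀ U₀ (toL2 F K c₀ (Hx Y))) = 0)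
    (hslotH : ∀ Y, Δx U₀ (toL2 F K c₀ (Hx Y))
      = (((eta F n K : ℝ) : ℂ)) • (LinearMap.adjoint (Qk F n K h c₀ cB U₀) (KinvT F n K h c₀ cB a Δx U₀ (toL2B F n cB Y))
          - LinearMap.adjoint (Qk F n K h c₀ cB U₀) (((a : ℂ)) • toL2B F n cB Y)))
    (h46 : ∀ (Y : PBond (F.P n) 0 → Matrix (Fin 2) (Fin 2) ℂ) (b : PBond (F.P K) 0), ‖Hx Y b‖ ≤ BH * eta F n K * ‖Y‖)
    (h137 : ∀ (Y : PBond (F.P n) 0 → Matrix (Fin 2) (Fin 2) ℂ) (b : PBond (F.P K) 0),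
      ‖(toL2 F K c₀).symm (LinearMap.adjoint (Qk F n K h c₀ cB U₀) (KinvT F n K h c₀ cB a Δx U₀ (toL2B F n cB Y))
          - LinearMap.adjoint (Qk F n K h c₀ cB U₀) (((a : ℂ)) • toL2B F n cB Y)) b‖ ≤ c137 * ‖Y‖)
    (hOp139 : ∀ (X : PBond (F.P K) 0 → Matrix (Fin 2) (Fin 2) ℂ) (s : ℝ), RS F n K h c₀ cB U₀ (DstarL2 F n K c₀ U₀ (toL2 F K c₀ X)) = 0 → (∀ bd, ‖X bd‖ ≤ s) →
      ∀ bd : PBond (F.P K) 0, ‖(toL2 F K c₀).symm (DeltaEta F n K c₀ U₀ (toL2 F K c₀ X) - Δx U₀ (toL2 F K c₀ X)) bd‖ ≤ k139 * s)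
    (hOp349 : ∀ (X : PBond (F.P K) 0 → Matrix (Fin 2) (Fin 2) ℂ) (s : ℝ), (∀ bd, ‖X bd‖ ≤ s) → ∀ bd : PBond (F.P K) 0,
      ‖(toL2 F K c₀).symm (DL2 F n K c₀ U₀ (DstarL2 F n K c₀ U₀ (toL2 F K c₀ X) - RS F n K h c₀ cB U₀ (DstarL2 F n K c₀ U₀ (toL2 F K c₀ X)))) bd‖ ≤ k349 * s)
    (Y : PBond (F.P n) 0 → Matrix (Fin 2) (Fin 2) ℂ) (ν : Fin (F.P K).d) (x : Site (F.P K) 0) :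
    ‖covLapFormT 1 (bgUnits F K U₀) (Hx Y) ν x‖
      ≤ (c137 + k139 * BH + 28 * ε₀ * BH + k349 * BH + 4 * ε₀ * BH) * eta F n K ^ 3 * ‖Y‖ := by
  have hη : 0 < eta F n K := eta_pos F n K
  set Fv := Hx Y with hFv
  have hDD := covCodiffCurlT_Hx_le (h := h) hreg Hx hLandau hslotH h46 h137 hOp139 Y ν x
  have hW := norm_covCodiffCurlT_sub_covLapFormT_add_gradDiv_le_of_regPr F n K U₀ hreg (X := Fv) (fun b => h46 Y b) ν x
  have hG := hDPD_of_op349 (h := h) (cB := cB) U₀ hOp349 Fv (hLandau Y) (fun b => h46 Y b) ν x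
  rw [← hFv] at hDD
  have hdecomp : covLapFormT 1 (bgUnits F K U₀) Fv ν x
      = covCodiffCurlT 1 (bgUnits F K U₀) Fv ν x
        + covDerivFwdT 1 (bgUnits F K U₀) ν (covDivFormT 1 (bgUnits F K U₀) Fv) x
        - (covCodiffCurlT 1 (bgUnits F K U₀) Fv ν x
            - (covLapFormT 1 (bgUnits F K U₀) Fv ν x - covDerivFwdT 1 (bgUnits F K U₀) ν (covDivFormT 1 (bgUnits F K U₀) Fv) x)) := by
    abel
  rw [hdecomp]
  calc ‖covCodiffCurlT 1 (bgUnits F K U₀) Fv ν x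
        + covDerivFwdT 1 (bgUnits F K U₀) ν (covDivFormT 1 (bgUnits F K U₀) Fv) x
        - (covCodiffCurlT 1 (bgUnits F K U₀) Fv ν x
            - (covLapFormT 1 (bgUnits F K U₀) Fv ν x - covDerivFwdT 1 (bgUnits F K U₀) ν (covDivFormT 1 (bgUnits F K U₀) Fv) x))‖
      ≤ ‖covCodiffCurlT 1 (bgUnits F K U₀) Fv ν x‖
        + ‖covDerivFwdT 1 (bgUnits F K U₀) ν (covDivFormT 1 (bgUnits F K U₀) Fv) x‖
        + ‖covCodiffCurlT 1 (bgUnits F K U₀) Fv ν x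
            - (covLapFormT 1 (bgUnits F K U₀) Fv ν x - covDerivFwdT 1 (bgUnits F K U₀) ν (covDivFormT 1 (bgUnits F K U₀) Fv) x)‖ :=
        norm_sub_le_of_le (norm_add_le _ _) le_rfl
    _ ≤ (c137 + k139 * BH + 28 * ε₀ * BH) * eta F n K ^ 3 * ‖Y‖ + k349 * (BH * eta F n K * ‖Y‖) * eta F n K ^ 2
        + 4 * ε₀ * eta F n K ^ 2 * (BH * eta F n K * ‖Y‖) := by
        gcongr
    _ = (c137 + k139 * BH + 28 * ε₀ * BH + k349 * BH + 4 * ε₀ * BH) * eta F n K ^ 3 * ‖Y‖ := by ring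

/-! ## §4 The row `hΔH` in the two-conjunct shape of record, for a generic letter at a generic slot -/

omit [Fact (0 < cB)] in
/-- The `BH` of an `h46`-type size row is non-negative as soon as the coarse lattice has a bond (read the row at `Y = 1`). [cite: Balaban1985Variational, (46) p.285] -/
theorem BH_nonneg_of_h46 (Hx : (PBond (F.P n) 0 → Matrix (Fin 2) (Fin 2) ℂ) → (PBond (F.P K) 0 → Matrix (Fin 2) (Fin 2) ℂ)) {BH : ℝ}
    (h46 : ∀ (Y : PBond (F.P n) 0 → Matrix (Fin 2) (Fin 2) ℂ) (b : PBond (F.P K) 0), ‖Hx Y b‖ ≤ BH * eta F n K * ‖Y‖) : 0 ≤ BH := by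
  have hη : 0 < eta F n K := eta_pos F n K
  have hY : (fun _ : PBond (F.P n) 0 => (1 : Matrix (Fin 2) (Fin 2) ℂ)) ≠ 0 :=
    fun h0 => one_ne_zero (congrFun h0 ⟨default, ⟨0, (F.P n).hd⟩⟩)
  have hpos : 0 < ‖(fun _ : PBond (F.P n) 0 => (1 : Matrix (Fin 2) (Fin 2) ℂ))‖ := norm_pos_iff.mpr hY
  have h1 := h46 (fun _ => 1) ⟨default, ⟨0, (F.P K).hd⟩⟩
  have h2 : 0 * (eta F n K * ‖(fun _ : PBond (F.P n) 0 => (1 : Matrix (Fin 2) (Fin 2) ℂ))‖)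
      ≤ BH * (eta F n K * ‖(fun _ : PBond (F.P n) 0 => (1 : Matrix (Fin 2) (Fin 2) ℂ))‖) := by
    rw [zero_mul, ← mul_assoc]; exact (norm_nonneg _).trans h1
  exact le_of_mul_le_mul_right h2 (mul_pos hη hpos)

/-- ★★★ **THE (S)-SUB-ROW `hΔH` FOR A GENERIC LETTER `Hx` AT A GENERIC SLOT `Δx`, FROM THE ROWS OF RECORD** ([Balaban1985Variational] (137)–(140) at the T³ member): for every block field
`Y`, `‖D¹*D¹(Hx Y)(b)‖ ≤ BH″·η³·‖Y‖` and `‖Δ¹(Hx Y)(b)‖ ≤ BH″·η³·‖Y‖`, `BH″ := c₁₃₇ + k₁₃₉·BH + k₃₄₉·BH + (28 + 4)·ε₀·BH` (✓p663021 §4's constant), on `RegPr ε₀ U₀`, from the letter rows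
`hLandau hslotH h46` and the background rows `h137 hOp139′ hOp349` — NO positivity class, NO `G′` letter; the h46₂ family door v2 instantiates it at `Hx := H46ᴾ`, `Δx := DeltaPiSlotᴾ`.
[cite: Balaban1985Variational, (137)–(140) pp.298–299, (19) p.281, (45)–(46) p.285; Balaban1985BackgroundPropagators, (3.10) p.392, (3.49) p.399] -/
theorem hΔH_of_opRows_slot {ε₀ : ℝ} {U₀ : GaugeField (F.P K) 0 (Matrix.specialUnitaryGroup (Fin 2) ℂ)} (hreg : RegPr F n K ε₀ U₀)
    (Hx : (PBond (F.P n) 0 → Matrix (Fin 2) (Fin 2) ℂ) → (PBond (F.P K) 0 → Matrix (Fin 2) (Fin 2) ℂ)) {BH c137 k139 k349 : ℝ} (hε₀ : 0 ≤ ε₀)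
    (hLandau : ∀ Y, RS F n K h c₀ cB U₀ (DstarL2 F n K c₀ U₀ (toL2 F K c₀ (Hx Y))) = 0)
    (hslotH : ∀ Y, Δx U₀ (toL2 F K c₀ (Hx Y))
      = (((eta F n K : ℝ) : ℂ)) • (LinearMap.adjoint (Qk F n K h c₀ cB U₀) (KinvT F n K h c₀ cB a Δx U₀ (toL2B F n cB Y))
          - LinearMap.adjoint (Qk F n K h c₀ cB U₀) (((a : ℂ)) • toL2B F n cB Y)))
    (h46 : ∀ (Y : PBond (F.P n) 0 → Matrix (Fin 2) (Fin 2) ℂ) (b : PBond (F.P K) 0), ‖Hx Y b‖ ≤ BH * eta F n K * ‖Y‖)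
    (h137 : ∀ (Y : PBond (F.P n) 0 → Matrix (Fin 2) (Fin 2) ℂ) (b : PBond (F.P K) 0),
      ‖(toL2 F K c₀).symm (LinearMap.adjoint (Qk F n K h c₀ cB U₀) (KinvT F n K h c₀ cB a Δx U₀ (toL2B F n cB Y))
          - LinearMap.adjoint (Qk F n K h c₀ cB U₀) (((a : ℂ)) • toL2B F n cB Y)) b‖ ≤ c137 * ‖Y‖)
    (hOp139 : ∀ (X : PBond (F.P K) 0 → Matrix (Fin 2) (Fin 2) ℂ) (s : ℝ), RS F n K h c₀ cB U₀ (DstarL2 F n K c₀ U₀ (toL2 F K c₀ X)) = 0 → (∀ bd, ‖X bd‖ ≤ s) →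
      ∀ bd : PBond (F.P K) 0, ‖(toL2 F K c₀).symm (DeltaEta F n K c₀ U₀ (toL2 F K c₀ X) - Δx U₀ (toL2 F K c₀ X)) bd‖ ≤ k139 * s)
    (hOp349 : ∀ (X : PBond (F.P K) 0 → Matrix (Fin 2) (Fin 2) ℂ) (s : ℝ), (∀ bd, ‖X bd‖ ≤ s) → ∀ bd : PBond (F.P K) 0,
      ‖(toL2 F K c₀).symm (DL2 F n K c₀ U₀ (DstarL2 F n K c₀ U₀ (toL2 F K c₀ X) - RS F n K h c₀ cB U₀ (DstarL2 F n K c₀ U₀ (toL2 F K c₀ X)))) bd‖ ≤ k349 * s) :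
    (∀ (Y : PBond (F.P n) 0 → Matrix (Fin 2) (Fin 2) ℂ) (μ : Fin (F.P K).d) (x : Site (F.P K) 0),
        ‖covCodiffCurlT 1 (bgUnits F K U₀) (Hx Y) μ x‖ ≤ (c137 + k139 * BH + k349 * BH + (28 + 4) * ε₀ * BH) * eta F n K ^ 3 * ‖Y‖) ∧
    (∀ (Y : PBond (F.P n) 0 → Matrix (Fin 2) (Fin 2) ℂ) (ν : Fin (F.P K).d) (x : Site (F.P K) 0),
        ‖covLapFormT 1 (bgUnits F K U₀) (Hx Y) ν x‖ ≤ (c137 + k139 * BH + k349 * BH + (28 + 4) * ε₀ * BH) * eta F n K ^ 3 * ‖Y‖) := by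
  have hη : 0 < eta F n K := eta_pos F n K
  have hBH : 0 ≤ BH := BH_nonneg_of_h46 (K := K) Hx h46
  have hk349 : 0 ≤ k349 := k_nonneg_of_op349 (n := n) (h := h) (cB := cB) U₀ hOp349
  refine ⟨fun Y μ x => ?_, fun Y ν x => ?_⟩
  · have h1 := covCodiffCurlT_Hx_le (h := h) hreg Hx hLandau hslotH h46 h137 hOp139 Y μ x
    have hextra : 0 ≤ (k349 * BH + 4 * ε₀ * BH) * eta F n K ^ 3 * ‖Y‖ := by positivity
    calc _ ≤ (c137 + k139 * BH + 28 * ε₀ * BH) * eta F n K ^ 3 * ‖Y‖ := h1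
      _ ≤ (c137 + k139 * BH + 28 * ε₀ * BH) * eta F n K ^ 3 * ‖Y‖ + (k349 * BH + 4 * ε₀ * BH) * eta F n K ^ 3 * ‖Y‖ :=
          le_add_of_nonneg_right hextra
      _ = (c137 + k139 * BH + k349 * BH + (28 + 4) * ε₀ * BH) * eta F n K ^ 3 * ‖Y‖ := by ring
  · have h2 := covLapFormT_Hx_le (h := h) hreg Hx hLandau hslotH h46 h137 hOp139 hOp349 Y ν x
    calc _ ≤ (c137 + k139 * BH + 28 * ε₀ * BH + k349 * BH + 4 * ε₀ * BH) * eta F n K ^ 3 * ‖Y‖ := h2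
      _ = (c137 + k139 * BH + k349 * BH + (28 + 4) * ε₀ * BH) * eta F n K ^ 3 * ‖Y‖ := by ring

end Summit.QuantumFields.YangMills.Theorems.Prop7SectET3HDeltaHOfOpRowsSlot

end
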